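import Literature.MathematicalPhysics.QuantumFieldTheory.Balaban1983to89.B1Eq324BenfattoKernelSect5SlotMoments
import Literature.MathematicalPhysics.QuantumFieldTheory.Balaban1983to89.B1Eq324BenfattoSect5PolyClusters
import Literature.MathematicalPhysics.QuantumFieldTheory.Balaban1983to89.B1Eq324BenfattoKernelCondToFree
import HarnessLib

/-!
# `Balaban1983to89.B1Eq324BenfattoKernelSect5PolyClusters` — [BenfattoEtAl1978] §5 pp. 157–158, (5.29) second term / (5.31) «(error)»
# FOR POLYNOMIAL SLOTS UNDER A SHIFTED GAUSSIAN KERNEL FIELD `𝒩(0,K)∘(u + ·)⁻¹`: the exponential clustering of the joint truncated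
# expectations of polynomial slots (Appendix D ii) with DISPLAYED source and propagator rows), and their closeness for two shifted
# kernel fields with leg-wise `ε`-close centres and propagators — PROVED

statement-level skeleton of published theorems with citation tags; proofs where landed; nothing here is a claim about the
Yang–Mills mass gap

WHY THIS MODULE (cell `pub-ymgap`, seat `dag-n08-c` gen 31; node N08 [Balaban1985UV3]; the [BenfattoEtAl1978] source chain behind the
(α)-row `h324`; ROW 2 of the seat's cluster-side port map `N08-PORT-MAP-CLUSTER-SIDE.md` §1).  `…B1Eq324BenfattoSect5PolyClusters` lifts the
two monomial-cluster theorems of the §5 road — Appendix D ii)'s clustering (*"the only terms that survive are the so called "connected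
diagrams" … the exponential factors … give rise to an overall dumping factor"*, p. 166) and (5.31)'s «(error)» (*"𝓔^T_z̄ … differ very
little from the … unconditional ones"*, p. 153) — to POLYNOMIAL slots, for the conditioned FREE field `condField d α β Γ z̄` versus the free
field `P0 d α β`.  On the class road the per-box measures are shifted Gaussian fields of a general kernel (the part fields
`N^K_{P,ξ} = (gaussianFieldOfKernel K_P).map (u_Γ(ξ) + ·)` of `…KernelSect5Eq513`), and both monomial-cluster inputs already exist for
them: Appendix D ii) for `(gaussianFieldOfKernel K).map (u + ·)` with a pseudo-distance and the rows `|u(x_l)| ≤ K₀`,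
`|K(x_a,x_b)| ≤ K₀e^{−δρ}` (`…KernelAppendixD.abs_ursellOf_shift_monomials_le_exp`, seat n08-c g23), and the two-field comparison
`|𝓔^T_{μ_{K₁,u₁}} − 𝓔^T_{μ_{K₀,u₀}}| ≤ 2^{|Λ|}2^{2^{|Λ|}}|Λ|R^{|Λ|}ε` from leg-wise `ε`-closeness (`…KernelCondToFree.abs_ursellOf_shift_sub_shift_le`
/ `_sub_kernel_le`, seat n08-b g10).  This file is the polynomial-slot layer over them — the SAME three steps as the concrete module, BY
NAME: the bridge between p13's leg currency and the slot currency (`…Sect5PolyClusters.ursellOf_legs_sigma_eq`, `card_sigma_coe`,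
`sum_filter_sameOwner_sigma_eq`), the colouring expansion (`abs_ursellOf_poly_le_of_colourings`, `abs_ursellOf_poly_sub_le_of_colourings`,
`condFreeConst_mono`), and the integrability of the monomials (row 1, `…KernelSect5SlotMoments.integrable_abs_poly_eval_pow_shift`).  The
reference field of the comparison is left OPEN in two shapes — a second shifted kernel field `μ_{K₀,u₀}` (§2, `K_ref` agnostic) and the
centred field `gaussianFieldOfKernel K₀` (§3; the free side's `K_ref = K_Λ` of record, n08-b `N08-CLASS-TOOLKIT.md` §6).

DICTIONARY.  `μ_{K,u}` ↦ `(gaussianFieldOfKernel K).map fun ζ y => u y + ζ y` (VERBATIM, the tree's convention); rows: R0 `hK : IsPosSemidefKernel K`,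
R1 `hdiag : ∀ y, K y y ≤ c₀` (integrability only), R2/R3 in Appendix D's leg form `|u(x_{jl})| ≤ K₀`, `|K(x_{jl},x_{j'l'})| ≤ K₀e^{−δρ}` with a
pseudo-distance `ρ` on the index set (`ρ(t,t) = 0`, symmetric, triangle, `≥ 0`), R4 in (5.31)'s leg form `|u₁ − u₀| ≤ ε`, `|K₁ − K₀| ≤ ε`,
a-priori `≤ R`.  Slots `Z_j = Σ_c a_{jc} Π_{l∈J_{jc}} z(x_{jcl})`, colourings `f : σ → ι`.  The concrete module is the instance
`K := condCov (freeCov d α β) Γ`, `u := condMean (freeCov d α β) Γ z̄`, `K₀ := freeCov d α β` (`…Sect5SlotMoments.condField_eq_map`).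

WHAT IS PROVED (theorems only; no definition, no named fact, no `sorry`; axioms standard; index types in `Type` as in the two inputs).
* §1 APPENDIX D FOR POLYNOMIAL SLOTS under `μ_{K,u}`: `integrable_abs_monomial_pow_shift`, ★ `abs_ursellOf_monomials_shift_le_exp` (one family of
  monomials, slot currency, designated legs displayed), ★★ `abs_ursellOf_poly_shift_le_exp` (the colouring sum of the per-cluster bounds weighted
  by `Π_j|a_{jf(j)}|`).
* §2 (5.31) FOR POLYNOMIAL SLOTS, TWO SHIFTED FIELDS `μ_{K₁,u₁}` vs `μ_{K₀,u₀}`: ★ `abs_ursellOf_monomials_shift_sub_shift_le`,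
  ★★ `abs_ursellOf_poly_shift_sub_shift_le` (`≤ (Π_jΣ_c|a_{jc}|)·2^N 2^{2^N} N R^N ε`, `N = kq`).
* §3 (5.31) FOR POLYNOMIAL SLOTS versus the CENTRED field `gaussianFieldOfKernel K₀`: `integrable_abs_monomial_pow_kernel`,
  ★ `abs_ursellOf_monomials_shift_sub_kernel_le`, ★★ `abs_ursellOf_poly_shift_sub_kernel_le`.

HONEST SCOPE / NOT HERE.  The rows are DISPLAYED, not discharged (at the class's per-box instance they are `…KernelOfPrecision` F2–F7 /
`…ClassAppendixC`, port map §2); the uniformisation of the per-colouring exponents is the corridor geometry (`…Sect5TupleClusters*`, row 3–5 of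
the port map, not here); one self-located row of an UNCOMMISSIONED port (plan g81 (II), START-LIST v11 §n08) — nothing chained; no generalised
Basic Lemma is stated; nothing of [Balaban1985UV3] is asserted; count-neutral for N08; nothing about d = 4, the continuum, OS axioms, a mass
gap or the Clay problem.
-/

open Finset MeasureTheory
open scoped BigOperators NNReal

namespace Literature.MathematicalPhysics.QuantumFieldTheory.Balaban1983to89.B1Eq324BenfattoKernelSect5PolyClusters

open _root_.MeasureTheory _root_.ProbabilityTheory
open Literature.Probability.LatticeModels (setPartitions ursellOf)
open Literature.Probability.LatticeModels.LegDiagram (legs)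
open Literature.MathematicalPhysics.QuantumFieldTheory
open Literature.MathematicalPhysics.QuantumFieldTheory.Balaban1983to89.B1Eq323ConnectedGraphBound (allV)
open Literature.MathematicalPhysics.QuantumFieldTheory.Balaban1983to89.B1Eq324GaussianMomentLeaf (poly)
open Literature.MathematicalPhysics.QuantumFieldTheory.Balaban1983to89.B1Eq324BenfattoSect5PolyClusters
  (ursellOf_legs_sigma_eq abs_ursellOf_poly_le_of_colourings sum_filter_sameOwner_sigma_eq card_sigma_coe
   abs_ursellOf_poly_sub_le_of_colourings condFreeConst_mono)
open Literature.MathematicalPhysics.QuantumFieldTheory.Balaban1983to89.B1Eq324BenfattoKernelSect5SlotMoments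
  (integrable_abs_poly_eval_pow_shift)
open Literature.MathematicalPhysics.QuantumFieldTheory.Balaban1983to89.B1Eq324BenfattoKernelAppendixD
  (abs_ursellOf_shift_monomials_le_exp)
open Literature.MathematicalPhysics.QuantumFieldTheory.Balaban1983to89.B1Eq324BenfattoKernelCondToFree
  (abs_ursellOf_shift_sub_shift_le abs_ursellOf_shift_sub_kernel_le)

/-! ## §1  Appendix D ii) for polynomial slots under a shifted kernel field -/

section AppendixD

variable {S : Type} [DecidableEq S] {K : S → S → ℝ}
variable {σ : Type} [Fintype σ] [DecidableEq σ] [Nonempty σ] {κ : Type}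

omit [Nonempty σ] in
/-- The monomials of the coordinates have `μ_{K,u}`-integrable absolute powers (one-term case of
`…KernelSect5SlotMoments.integrable_abs_poly_eval_pow_shift`; rows R0, R1). [cite: BenfattoEtAl1978, Appendix C 2) p.164] -/
theorem integrable_abs_monomial_pow_shift (hK : IsPosSemidefKernel K) (u : S → ℝ) {c₀ : ℝ≥0} (hdiag : ∀ y, K y y ≤ c₀)
    (Jl : Finset κ) (x : κ → S) (p : ℕ) :
    Integrable (fun z : S → ℝ => |∏ l ∈ Jl, z (x l)| ^ p)
      ((gaussianFieldOfKernel K).map fun (ζ : S → ℝ) (y : S) => u y + ζ y) := by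
  classical
  have h := integrable_abs_poly_eval_pow_shift hK u hdiag (Finset.univ : Finset Unit) (fun _ => Jl) (fun _ => (1 : ℝ))
    (fun _ l => x l) p
  refine h.congr (ae_of_all _ fun z => ?_)
  simp only [poly, Finset.univ_unique, Finset.sum_singleton, one_mul]

/-- **APPENDIX D ii) IN THE SLOT CURRENCY, SHIFTED KERNEL FIELD** — `…KernelAppendixD.abs_ursellOf_shift_monomials_le_exp` for ONE family of
monomials `Π_{l∈J_j} z(x_{jl})`, `j ∈ σ`, through the bridge (legs `Λ = (j : σ) × ↥(J_j)`, a linear order lifted from `Fintype.equivFin`): with a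
pseudo-distance `ρ` on the index set, rows `|u(x_{jl})| ≤ K₀`, `|K(x_{jl}, x_{j'l'})| ≤ K₀e^{−δρ}` on the legs (`K₀ ≥ 1`, `δ ≥ 0`) and two
designated legs `l₁ ∈ J_{j₁}`, `l₂ ∈ J_{j₂}`,
`|𝓔^T_{μ_{K,u}}(Π_{l∈J_j} z(x_{jl}), j∈σ)| ≤ 2^{N}·2^{2^{N}}·K₀^{N}·exp(−(δ/2)(ρ(x_{j₁l₁}, x_{j₂l₂}) − Σ_jΣ_{l,l'∈J_j}ρ(x_{jl},x_{jl'})))`, `N = Σ_j|J_j|`.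
The concrete `…Sect5PolyClusters.abs_ursellOf_monomials_condField_le_exp` is the instance `K := condCov (freeCov d α β) Γ`, `u := condMean … z̄`.
[cite: BenfattoEtAl1978, Appendix D p.166] -/
theorem abs_ursellOf_monomials_shift_le_exp (hK : IsPosSemidefKernel K) (u : S → ℝ) (Jm : σ → Finset κ) (xs : σ → κ → S)
    (ρ : S → S → ℝ) {K₀ δ : ℝ}
    (h0 : ∀ t, ρ t t = 0) (hsymm : ∀ t t', ρ t t' = ρ t' t) (htri : ∀ t t' t'', ρ t t'' ≤ ρ t t' + ρ t' t'')
    (hnn : ∀ t t', 0 ≤ ρ t t') (hK₀ : 1 ≤ K₀) (hδ : 0 ≤ δ)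
    (hu : ∀ j, ∀ l ∈ Jm j, |u (xs j l)| ≤ K₀)
    (hC : ∀ j j', ∀ l ∈ Jm j, ∀ l' ∈ Jm j', |K (xs j l) (xs j' l')| ≤ K₀ * Real.exp (-(δ * ρ (xs j l) (xs j' l'))))
    {j₁ j₂ : σ} {l₁ l₂ : κ} (hl₁ : l₁ ∈ Jm j₁) (hl₂ : l₂ ∈ Jm j₂) :
    |ursellOf (fun P : Finset σ => ∫ z, ∏ j ∈ P, ∏ l ∈ Jm j, z (xs j l)
        ∂((gaussianFieldOfKernel K).map fun (ζ : S → ℝ) (y : S) => u y + ζ y)) Finset.univ| ≤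
      2 ^ (∑ j, (Jm j).card) * 2 ^ 2 ^ (∑ j, (Jm j).card) * (K₀ ^ (∑ j, (Jm j).card) *
        Real.exp (-(δ / 2 * (ρ (xs j₁ l₁) (xs j₂ l₂) -
          ∑ j, ∑ l ∈ Jm j, ∑ l' ∈ Jm j, ρ (xs j l) (xs j l'))))) := by
  letI : LinearOrder ((j : σ) × ↥(Jm j)) :=
    LinearOrder.lift' (Fintype.equivFin ((j : σ) × ↥(Jm j))) (Fintype.equivFin _).injective
  have h := abs_ursellOf_shift_monomials_le_exp (Sigma.fst : ((j : σ) × ↥(Jm j)) → σ) hK u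
    (fun a => xs a.1 a.2) (fun a b => ρ (xs a.1 a.2) (xs b.1 b.2)) (fun a => h0 _) (fun a b => hsymm _ _)
    (fun a b c => htri _ _ _) (fun a b => hnn _ _) hK₀ hδ (fun a => hu a.1 a.2 a.2.2)
    (fun a b => hC a.1 b.1 a.2 a.2.2 b.2 b.2.2) ⟨j₁, ⟨l₁, hl₁⟩⟩ ⟨j₂, ⟨l₂, hl₂⟩⟩
  rw [ursellOf_legs_sigma_eq ((gaussianFieldOfKernel K).map fun (ζ : S → ℝ) (y : S) => u y + ζ y) Jm
      (fun j l (z : S → ℝ) => z (xs j l)),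
    card_sigma_coe, sum_filter_sameOwner_sigma_eq Jm (fun j l j' l' => ρ (xs j l) (xs j' l'))] at h
  exact h

variable {ι : Type*} [Fintype ι] [Nonempty ι]

/-- **APPENDIX D ii) FOR POLYNOMIAL SLOTS UNDER A SHIFTED KERNEL FIELD** (the second term of (5.29) before the geometry): for slots
`Z_j = Σ_c a_{jc} Π_{l∈J_{jc}} z(x_{jcl})` under `μ_{K,u}` (rows R0 `hK`, R1 `hdiag` for integrability), with the leg rows of
`abs_ursellOf_monomials_shift_le_exp` for every colouring `f` and designated legs `l₁(f) ∈ J_{j₁ f(j₁)}`, `l₂(f) ∈ J_{j₂ f(j₂)}`,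
`|𝓔^T_{μ_{K,u}}(Z₁,…,Z_k)| ≤ Σ_f (Π_j|a_{jf(j)}|)·2^{N_f}2^{2^{N_f}}K₀^{N_f}·exp(−(δ/2)(ρ(x_{j₁f l₁(f)}, x_{j₂f l₂(f)}) − intra_f))`.
The concrete `…Sect5PolyClusters.abs_ursellOf_poly_condField_le_exp` is the instance `K := condCov (freeCov d α β) Γ`, `u := condMean … z̄`.
[cite: BenfattoEtAl1978, (5.29) p.158 and Appendix D p.166] -/
theorem abs_ursellOf_poly_shift_le_exp (hK : IsPosSemidefKernel K) (u : S → ℝ) {c₀ : ℝ≥0} (hdiag : ∀ y, K y y ≤ c₀)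
    (a : σ → ι → ℝ) (Jm : σ → ι → Finset κ) (xs : σ → ι → κ → S)
    (ρ : S → S → ℝ) {K₀ δ : ℝ}
    (h0 : ∀ t, ρ t t = 0) (hsymm : ∀ t t', ρ t t' = ρ t' t) (htri : ∀ t t' t'', ρ t t'' ≤ ρ t t' + ρ t' t'')
    (hnn : ∀ t t', 0 ≤ ρ t t') (hK₀ : 1 ≤ K₀) (hδ : 0 ≤ δ)
    (hu : ∀ j c, ∀ l ∈ Jm j c, |u (xs j c l)| ≤ K₀)
    (hC : ∀ j c j' c', ∀ l ∈ Jm j c, ∀ l' ∈ Jm j' c',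
      |K (xs j c l) (xs j' c' l')| ≤ K₀ * Real.exp (-(δ * ρ (xs j c l) (xs j' c' l'))))
    (j₁ j₂ : σ) (l₁ l₂ : (σ → ι) → κ) (hl₁ : ∀ f, l₁ f ∈ Jm j₁ (f j₁)) (hl₂ : ∀ f, l₂ f ∈ Jm j₂ (f j₂)) :
    |ursellOf (fun P : Finset σ => ∫ z, ∏ j ∈ P, (∑ c, a j c * ∏ l ∈ Jm j c, z (xs j c l))
        ∂((gaussianFieldOfKernel K).map fun (ζ : S → ℝ) (y : S) => u y + ζ y)) Finset.univ| ≤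
      ∑ f : σ → ι, (∏ j, |a j (f j)|) *
        (2 ^ (∑ j, (Jm j (f j)).card) * 2 ^ 2 ^ (∑ j, (Jm j (f j)).card) * (K₀ ^ (∑ j, (Jm j (f j)).card) *
          Real.exp (-(δ / 2 * (ρ (xs j₁ (f j₁) (l₁ f)) (xs j₂ (f j₂) (l₂ f)) -
            ∑ j, ∑ l ∈ Jm j (f j), ∑ l' ∈ Jm j (f j), ρ (xs j (f j) l) (xs j (f j) l')))))) := by
  haveI := isProbabilityMeasure_gaussianFieldOfKernel hK
  have hTm : Measurable (fun (ζ : S → ℝ) (y : S) => u y + ζ y) :=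
    measurable_pi_lambda _ fun y => measurable_const.add (measurable_pi_apply y)
  haveI : IsProbabilityMeasure ((gaussianFieldOfKernel K).map fun (ζ : S → ℝ) (y : S) => u y + ζ y) :=
    Measure.isProbabilityMeasure_map hTm.aemeasurable
  refine abs_ursellOf_poly_le_of_colourings a (fun j c (z : S → ℝ) => ∏ l ∈ Jm j c, z (xs j c l))
    (fun j c => (Finset.measurable_prod (Jm j c) fun l _ => measurable_pi_apply (xs j c l)).aestronglyMeasurable)
    (fun j c p _ => integrable_abs_monomial_pow_shift hK u hdiag (Jm j c) (xs j c) p) _ fun f => ?_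
  exact abs_ursellOf_monomials_shift_le_exp hK u (fun j => Jm j (f j)) (fun j => xs j (f j)) ρ h0 hsymm htri hnn
    hK₀ hδ (fun j l hl => hu j (f j) l hl) (fun j j' l hl l' hl' => hC j (f j) j' (f j') l hl l' hl') (hl₁ f) (hl₂ f)

end AppendixD

/-! ## §2  (5.31) «(error)» for polynomial slots: two shifted kernel fields -/

section TwoShifts

variable {S : Type} [DecidableEq S] {K₁ K₀ : S → S → ℝ}
variable {σ : Type} [Fintype σ] [DecidableEq σ] [Nonempty σ] {κ : Type}

/-- **(5.31) IN THE SLOT CURRENCY, TWO SHIFTED KERNEL FIELDS** — `…KernelCondToFree.abs_ursellOf_shift_sub_shift_le` for one family of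
monomials through the bridge: leg-wise `|u₁ − u₀| ≤ ε`, `|K₁ − K₀| ≤ ε` and a-priori `|u₁|, |u₀|, |K₁|, |K₀| ≤ R` (`R ≥ 1`, `ε ≥ 0`) give
`|𝓔^T_{μ_{K₁,u₁}}(Π_{l∈J_j} z(x_{jl}), j∈σ) − 𝓔^T_{μ_{K₀,u₀}}(…)| ≤ 2^{N}2^{2^{N}}·N·R^{N}·ε`, `N = Σ_j|J_j|`.
[cite: BenfattoEtAl1978, (5.31) p.158 and p.153] -/
theorem abs_ursellOf_monomials_shift_sub_shift_le (hK₁ : IsPosSemidefKernel K₁) (hK₀ : IsPosSemidefKernel K₀)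
    (u₁ u₀ : S → ℝ) (Jm : σ → Finset κ) (xs : σ → κ → S) {R ε : ℝ} (hR : 1 ≤ R) (hε : 0 ≤ ε)
    (hu₁R : ∀ j, ∀ l ∈ Jm j, |u₁ (xs j l)| ≤ R) (hu₀R : ∀ j, ∀ l ∈ Jm j, |u₀ (xs j l)| ≤ R)
    (hK₁R : ∀ j j', ∀ l ∈ Jm j, ∀ l' ∈ Jm j', |K₁ (xs j l) (xs j' l')| ≤ R)
    (hK₀R : ∀ j j', ∀ l ∈ Jm j, ∀ l' ∈ Jm j', |K₀ (xs j l) (xs j' l')| ≤ R)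
    (huε : ∀ j, ∀ l ∈ Jm j, |u₁ (xs j l) - u₀ (xs j l)| ≤ ε)
    (hKε : ∀ j j', ∀ l ∈ Jm j, ∀ l' ∈ Jm j', |K₁ (xs j l) (xs j' l') - K₀ (xs j l) (xs j' l')| ≤ ε) :
    |ursellOf (fun P : Finset σ => ∫ z, ∏ j ∈ P, ∏ l ∈ Jm j, z (xs j l)
          ∂((gaussianFieldOfKernel K₁).map fun (ζ : S → ℝ) (y : S) => u₁ y + ζ y)) Finset.univ -
        ursellOf (fun P : Finset σ => ∫ z, ∏ j ∈ P, ∏ l ∈ Jm j, z (xs j l)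
          ∂((gaussianFieldOfKernel K₀).map fun (ζ : S → ℝ) (y : S) => u₀ y + ζ y)) Finset.univ| ≤
      2 ^ (∑ j, (Jm j).card) * 2 ^ 2 ^ (∑ j, (Jm j).card) *
        ((∑ j, (Jm j).card : ℕ) * R ^ (∑ j, (Jm j).card) * ε) := by
  letI : LinearOrder ((j : σ) × ↥(Jm j)) :=
    LinearOrder.lift' (Fintype.equivFin ((j : σ) × ↥(Jm j))) (Fintype.equivFin _).injective
  have h := abs_ursellOf_shift_sub_shift_le (Sigma.fst : ((j : σ) × ↥(Jm j)) → σ) hK₁ hK₀ u₁ u₀ (fun a => xs a.1 a.2) hR hε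
    (fun a => hu₁R a.1 a.2 a.2.2) (fun a => hu₀R a.1 a.2 a.2.2) (fun a b => hK₁R a.1 b.1 a.2 a.2.2 b.2 b.2.2)
    (fun a b => hK₀R a.1 b.1 a.2 a.2.2 b.2 b.2.2) (fun a => huε a.1 a.2 a.2.2)
    (fun a b => hKε a.1 b.1 a.2 a.2.2 b.2 b.2.2)
  rw [ursellOf_legs_sigma_eq ((gaussianFieldOfKernel K₁).map fun (ζ : S → ℝ) (y : S) => u₁ y + ζ y) Jm
      (fun j l (z : S → ℝ) => z (xs j l)),
    ursellOf_legs_sigma_eq ((gaussianFieldOfKernel K₀).map fun (ζ : S → ℝ) (y : S) => u₀ y + ζ y) Jm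
      (fun j l (z : S → ℝ) => z (xs j l)),
    card_sigma_coe] at h
  exact_mod_cast h

variable {ι : Type*} [Fintype ι] [Nonempty ι]

/-- **(5.31) «(error)» FOR POLYNOMIAL SLOTS, TWO SHIFTED KERNEL FIELDS**: for slots `Z_j = Σ_c a_{jc} Π_{l∈J_{jc}} z(x_{jcl})` of degree `≤ q`
(`|J_{jc}| ≤ q`) under `μ_{K₁,u₁}` and `μ_{K₀,u₀}` (rows R0 `hK₁ hK₀`, R1 `hdiag₁ hdiag₀` for integrability) whose legs all satisfy
`|u₁ − u₀| ≤ ε`, `|K₁ − K₀| ≤ ε`, `|u₁|, |u₀|, |K₁|, |K₀| ≤ R` (`R ≥ 1`, `ε ≥ 0`),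
`|𝓔^T_{μ_{K₁,u₁}}(Z₁,…,Z_k) − 𝓔^T_{μ_{K₀,u₀}}(Z₁,…,Z_k)| ≤ (Π_jΣ_c|a_{jc}|)·2^{N}2^{2^{N}}·N·R^{N}·ε`, `N = kq` — «the error can be studied along
the same lines … and has the same form of (5.29) with new constants». [cite: BenfattoEtAl1978, (5.31) p.158 and p.153] -/
theorem abs_ursellOf_poly_shift_sub_shift_le (hK₁ : IsPosSemidefKernel K₁) (hK₀ : IsPosSemidefKernel K₀)
    (u₁ u₀ : S → ℝ) {c₁ c₀ : ℝ≥0} (hdiag₁ : ∀ y, K₁ y y ≤ c₁) (hdiag₀ : ∀ y, K₀ y y ≤ c₀)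
    (a : σ → ι → ℝ) (Jm : σ → ι → Finset κ) (xs : σ → ι → κ → S) {q : ℕ} (hq : ∀ j c, (Jm j c).card ≤ q)
    {R ε : ℝ} (hR : 1 ≤ R) (hε : 0 ≤ ε)
    (hu₁R : ∀ j c, ∀ l ∈ Jm j c, |u₁ (xs j c l)| ≤ R) (hu₀R : ∀ j c, ∀ l ∈ Jm j c, |u₀ (xs j c l)| ≤ R)
    (hK₁R : ∀ j c j' c', ∀ l ∈ Jm j c, ∀ l' ∈ Jm j' c', |K₁ (xs j c l) (xs j' c' l')| ≤ R)
    (hK₀R : ∀ j c j' c', ∀ l ∈ Jm j c, ∀ l' ∈ Jm j' c', |K₀ (xs j c l) (xs j' c' l')| ≤ R)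
    (huε : ∀ j c, ∀ l ∈ Jm j c, |u₁ (xs j c l) - u₀ (xs j c l)| ≤ ε)
    (hKε : ∀ j c j' c', ∀ l ∈ Jm j c, ∀ l' ∈ Jm j' c',
      |K₁ (xs j c l) (xs j' c' l') - K₀ (xs j c l) (xs j' c' l')| ≤ ε) :
    |ursellOf (fun P : Finset σ => ∫ z, ∏ j ∈ P, (∑ c, a j c * ∏ l ∈ Jm j c, z (xs j c l))
          ∂((gaussianFieldOfKernel K₁).map fun (ζ : S → ℝ) (y : S) => u₁ y + ζ y)) Finset.univ -
        ursellOf (fun P : Finset σ => ∫ z, ∏ j ∈ P, (∑ c, a j c * ∏ l ∈ Jm j c, z (xs j c l))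
          ∂((gaussianFieldOfKernel K₀).map fun (ζ : S → ℝ) (y : S) => u₀ y + ζ y)) Finset.univ| ≤
      (∏ j, ∑ c, |a j c|) * (2 ^ (Fintype.card σ * q) * 2 ^ 2 ^ (Fintype.card σ * q) *
        ((Fintype.card σ * q : ℕ) * R ^ (Fintype.card σ * q) * ε)) := by
  haveI := isProbabilityMeasure_gaussianFieldOfKernel hK₁
  haveI := isProbabilityMeasure_gaussianFieldOfKernel hK₀
  have hTm : ∀ u : S → ℝ, Measurable (fun (ζ : S → ℝ) (y : S) => u y + ζ y) := fun u =>
    measurable_pi_lambda _ fun y => measurable_const.add (measurable_pi_apply y)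
  haveI : IsProbabilityMeasure ((gaussianFieldOfKernel K₁).map fun (ζ : S → ℝ) (y : S) => u₁ y + ζ y) :=
    Measure.isProbabilityMeasure_map (hTm u₁).aemeasurable
  haveI : IsProbabilityMeasure ((gaussianFieldOfKernel K₀).map fun (ζ : S → ℝ) (y : S) => u₀ y + ζ y) :=
    Measure.isProbabilityMeasure_map (hTm u₀).aemeasurable
  set N := Fintype.card σ * q with hN
  have hNf : ∀ f : σ → ι, ∑ j, (Jm j (f j)).card ≤ N := fun f =>
    calc ∑ j, (Jm j (f j)).card ≤ ∑ _j : σ, q := Finset.sum_le_sum fun j _ => hq j (f j)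
      _ = N := by rw [Finset.sum_const, smul_eq_mul, Finset.card_univ]
  refine (abs_ursellOf_poly_sub_le_of_colourings a (fun j c (z : S → ℝ) => ∏ l ∈ Jm j c, z (xs j c l))
    (fun j c => (Finset.measurable_prod (Jm j c) fun l _ => measurable_pi_apply (xs j c l)).aestronglyMeasurable)
    (fun j c => (Finset.measurable_prod (Jm j c) fun l _ => measurable_pi_apply (xs j c l)).aestronglyMeasurable)
    (fun j c p _ => integrable_abs_monomial_pow_shift hK₁ u₁ hdiag₁ (Jm j c) (xs j c) p)
    (fun j c p _ => integrable_abs_monomial_pow_shift hK₀ u₀ hdiag₀ (Jm j c) (xs j c) p)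
    (fun _ => (2 : ℝ) ^ N * 2 ^ 2 ^ N * ((N : ℝ) * R ^ N * ε))
    fun f => (abs_ursellOf_monomials_shift_sub_shift_le hK₁ hK₀ u₁ u₀ (fun j => Jm j (f j)) (fun j => xs j (f j)) hR hε
      (fun j l hl => hu₁R j (f j) l hl) (fun j l hl => hu₀R j (f j) l hl)
      (fun j j' l hl l' hl' => hK₁R j (f j) j' (f j') l hl l' hl') (fun j j' l hl l' hl' => hK₀R j (f j) j' (f j') l hl l' hl')
      (fun j l hl => huε j (f j) l hl) (fun j j' l hl l' hl' => hKε j (f j) j' (f j') l hl l' hl')).trans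
      (condFreeConst_mono hR hε (hNf f))).trans (le_of_eq ?_)
  rw [← Finset.sum_mul, Literature.MathematicalPhysics.QuantumFieldTheory.Balaban1983to89.B1Eq324BenfattoSect5PolyClusters.sum_prod_abs_eq_prod_sum]

end TwoShifts

/-! ## §3  (5.31) «(error)» for polynomial slots: a shifted kernel field versus a centred one -/

section ShiftVsKernel

variable {S : Type} [DecidableEq S] {K₁ K₀ : S → S → ℝ}
variable {σ : Type} [Fintype σ] [DecidableEq σ] [Nonempty σ] {κ : Type}

omit [Nonempty σ] in
/-- The monomials of the coordinates have integrable absolute powers under the CENTRED field `𝒩(0,K)` of a kernel with bounded diagonal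
(sub-Gaussian coordinates, `…Sect5SlotMoments.hasSubgaussianMGF_eval_gaussianFieldOfKernel`; r14's `integrable_abs_poly_pow`).
[cite: BenfattoEtAl1978, Appendix C 2) p.164] -/
theorem integrable_abs_monomial_pow_kernel {K : S → S → ℝ} (hK : IsPosSemidefKernel K) {c₀ : ℝ≥0} (hdiag : ∀ y, K y y ≤ c₀)
    (Jl : Finset κ) (x : κ → S) (p : ℕ) :
    Integrable (fun z : S → ℝ => |∏ l ∈ Jl, z (x l)| ^ p) (gaussianFieldOfKernel K) := by
  classical
  haveI := isProbabilityMeasure_gaussianFieldOfKernel hK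
  have hsg : ∀ m ∈ (Finset.univ : Finset Unit), ∀ l ∈ (fun _ : Unit => Jl) m,
      HasSubgaussianMGF (fun ζ : S → ℝ => ζ (x l)) c₀ (gaussianFieldOfKernel K) := fun _ _ l _ =>
    Literature.MathematicalPhysics.QuantumFieldTheory.Balaban1983to89.B1Eq324BenfattoSect5SlotMoments.hasSubgaussianMGF_eval_gaussianFieldOfKernel
      hK (x l) (hdiag _)
  have h := Literature.MathematicalPhysics.QuantumFieldTheory.Balaban1983to89.B1Eq324GaussianMomentLeaf.integrable_abs_poly_pow
    (a := fun _ => (1 : ℝ)) (X := fun (_ : Unit) l (ζ : S → ℝ) => ζ (x l)) hsg p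
  refine h.congr (ae_of_all _ fun z => ?_)
  simp only [poly, Finset.univ_unique, Finset.sum_singleton, one_mul]

/-- **(5.31) IN THE SLOT CURRENCY, SHIFTED versus CENTRED KERNEL FIELD** — `…KernelCondToFree.abs_ursellOf_shift_sub_kernel_le` for one family of
monomials through the bridge: leg-wise `|u₁| ≤ ε`, `|K₁ − K₀| ≤ ε` and a-priori `|u₁|, |K₁|, |K₀| ≤ R` (`R ≥ 1`, `ε ≥ 0`) give
`|𝓔^T_{μ_{K₁,u₁}}(Π_{l∈J_j} z(x_{jl}), j∈σ) − 𝓔^T_{𝒩(0,K₀)}(…)| ≤ 2^{N}2^{2^{N}}·N·R^{N}·ε`, `N = Σ_j|J_j|` (print's reference field `𝓔̂^T_0`; the class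
road's `K_ref = K_Λ`). The concrete `…Sect5PolyClusters.abs_ursellOf_monomials_condField_sub_P0_le` is the instance `K₁ := condCov (freeCov …) Γ`,
`u₁ := condMean … z̄`, `K₀ := freeCov d α β`. [cite: BenfattoEtAl1978, (5.31) p.158 and p.153] -/
theorem abs_ursellOf_monomials_shift_sub_kernel_le (hK₁ : IsPosSemidefKernel K₁) (hK₀ : IsPosSemidefKernel K₀)
    (u₁ : S → ℝ) (Jm : σ → Finset κ) (xs : σ → κ → S) {R ε : ℝ} (hR : 1 ≤ R) (hε : 0 ≤ ε)
    (hu₁R : ∀ j, ∀ l ∈ Jm j, |u₁ (xs j l)| ≤ R)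
    (hK₁R : ∀ j j', ∀ l ∈ Jm j, ∀ l' ∈ Jm j', |K₁ (xs j l) (xs j' l')| ≤ R)
    (hK₀R : ∀ j j', ∀ l ∈ Jm j, ∀ l' ∈ Jm j', |K₀ (xs j l) (xs j' l')| ≤ R)
    (huε : ∀ j, ∀ l ∈ Jm j, |u₁ (xs j l)| ≤ ε)
    (hKε : ∀ j j', ∀ l ∈ Jm j, ∀ l' ∈ Jm j', |K₁ (xs j l) (xs j' l') - K₀ (xs j l) (xs j' l')| ≤ ε) :
    |ursellOf (fun P : Finset σ => ∫ z, ∏ j ∈ P, ∏ l ∈ Jm j, z (xs j l)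
          ∂((gaussianFieldOfKernel K₁).map fun (ζ : S → ℝ) (y : S) => u₁ y + ζ y)) Finset.univ -
        ursellOf (fun P : Finset σ => ∫ z, ∏ j ∈ P, ∏ l ∈ Jm j, z (xs j l) ∂(gaussianFieldOfKernel K₀)) Finset.univ| ≤
      2 ^ (∑ j, (Jm j).card) * 2 ^ 2 ^ (∑ j, (Jm j).card) *
        ((∑ j, (Jm j).card : ℕ) * R ^ (∑ j, (Jm j).card) * ε) := by
  letI : LinearOrder ((j : σ) × ↥(Jm j)) :=
    LinearOrder.lift' (Fintype.equivFin ((j : σ) × ↥(Jm j))) (Fintype.equivFin _).injective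
  have h := abs_ursellOf_shift_sub_kernel_le (Sigma.fst : ((j : σ) × ↥(Jm j)) → σ) hK₁ hK₀ u₁ (fun a => xs a.1 a.2) hR hε
    (fun a => hu₁R a.1 a.2 a.2.2) (fun a b => hK₁R a.1 b.1 a.2 a.2.2 b.2 b.2.2)
    (fun a b => hK₀R a.1 b.1 a.2 a.2.2 b.2 b.2.2) (fun a => huε a.1 a.2 a.2.2)
    (fun a b => hKε a.1 b.1 a.2 a.2.2 b.2 b.2.2)
  rw [ursellOf_legs_sigma_eq ((gaussianFieldOfKernel K₁).map fun (ζ : S → ℝ) (y : S) => u₁ y + ζ y) Jm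
      (fun j l (z : S → ℝ) => z (xs j l)),
    ursellOf_legs_sigma_eq (gaussianFieldOfKernel K₀) Jm (fun j l (z : S → ℝ) => z (xs j l)),
    card_sigma_coe] at h
  exact_mod_cast h

variable {ι : Type*} [Fintype ι] [Nonempty ι]

/-- **(5.31) «(error)» FOR POLYNOMIAL SLOTS, SHIFTED versus CENTRED KERNEL FIELD**: for slots `Z_j = Σ_c a_{jc} Π_{l∈J_{jc}} z(x_{jcl})` of
degree `≤ q` under `μ_{K₁,u₁}` and under the centred `𝒩(0,K₀)` (rows R0 `hK₁ hK₀`, R1 `hdiag₁ hdiag₀` for integrability) whose legs all satisfy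
`|u₁| ≤ ε`, `|K₁ − K₀| ≤ ε`, `|u₁|, |K₁|, |K₀| ≤ R` (`R ≥ 1`, `ε ≥ 0`),
`|𝓔^T_{μ_{K₁,u₁}}(Z₁,…,Z_k) − 𝓔^T_{𝒩(0,K₀)}(Z₁,…,Z_k)| ≤ (Π_jΣ_c|a_{jc}|)·2^{N}2^{2^{N}}·N·R^{N}·ε`, `N = kq`. The concrete
`…Sect5PolyClusters.abs_ursellOf_poly_condField_sub_P0_le` is the instance `K₁ := condCov (freeCov …) Γ`, `u₁ := condMean … z̄`, `K₀ := freeCov d α β`.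
[cite: BenfattoEtAl1978, (5.31) p.158 and p.153] -/
theorem abs_ursellOf_poly_shift_sub_kernel_le (hK₁ : IsPosSemidefKernel K₁) (hK₀ : IsPosSemidefKernel K₀)
    (u₁ : S → ℝ) {c₁ c₀ : ℝ≥0} (hdiag₁ : ∀ y, K₁ y y ≤ c₁) (hdiag₀ : ∀ y, K₀ y y ≤ c₀)
    (a : σ → ι → ℝ) (Jm : σ → ι → Finset κ) (xs : σ → ι → κ → S) {q : ℕ} (hq : ∀ j c, (Jm j c).card ≤ q)
    {R ε : ℝ} (hR : 1 ≤ R) (hε : 0 ≤ ε)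
    (hu₁R : ∀ j c, ∀ l ∈ Jm j c, |u₁ (xs j c l)| ≤ R)
    (hK₁R : ∀ j c j' c', ∀ l ∈ Jm j c, ∀ l' ∈ Jm j' c', |K₁ (xs j c l) (xs j' c' l')| ≤ R)
    (hK₀R : ∀ j c j' c', ∀ l ∈ Jm j c, ∀ l' ∈ Jm j' c', |K₀ (xs j c l) (xs j' c' l')| ≤ R)
    (huε : ∀ j c, ∀ l ∈ Jm j c, |u₁ (xs j c l)| ≤ ε)
    (hKε : ∀ j c j' c', ∀ l ∈ Jm j c, ∀ l' ∈ Jm j' c',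
      |K₁ (xs j c l) (xs j' c' l') - K₀ (xs j c l) (xs j' c' l')| ≤ ε) :
    |ursellOf (fun P : Finset σ => ∫ z, ∏ j ∈ P, (∑ c, a j c * ∏ l ∈ Jm j c, z (xs j c l))
          ∂((gaussianFieldOfKernel K₁).map fun (ζ : S → ℝ) (y : S) => u₁ y + ζ y)) Finset.univ -
        ursellOf (fun P : Finset σ => ∫ z, ∏ j ∈ P, (∑ c, a j c * ∏ l ∈ Jm j c, z (xs j c l))
          ∂(gaussianFieldOfKernel K₀)) Finset.univ| ≤
      (∏ j, ∑ c, |a j c|) * (2 ^ (Fintype.card σ * q) * 2 ^ 2 ^ (Fintype.card σ * q) *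
        ((Fintype.card σ * q : ℕ) * R ^ (Fintype.card σ * q) * ε)) := by
  haveI := isProbabilityMeasure_gaussianFieldOfKernel hK₁
  haveI := isProbabilityMeasure_gaussianFieldOfKernel hK₀
  have hTm : Measurable (fun (ζ : S → ℝ) (y : S) => u₁ y + ζ y) :=
    measurable_pi_lambda _ fun y => measurable_const.add (measurable_pi_apply y)
  haveI : IsProbabilityMeasure ((gaussianFieldOfKernel K₁).map fun (ζ : S → ℝ) (y : S) => u₁ y + ζ y) :=
    Measure.isProbabilityMeasure_map hTm.aemeasurable
  set N := Fintype.card σ * q with hN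
  have hNf : ∀ f : σ → ι, ∑ j, (Jm j (f j)).card ≤ N := fun f =>
    calc ∑ j, (Jm j (f j)).card ≤ ∑ _j : σ, q := Finset.sum_le_sum fun j _ => hq j (f j)
      _ = N := by rw [Finset.sum_const, smul_eq_mul, Finset.card_univ]
  refine (abs_ursellOf_poly_sub_le_of_colourings a (fun j c (z : S → ℝ) => ∏ l ∈ Jm j c, z (xs j c l))
    (fun j c => (Finset.measurable_prod (Jm j c) fun l _ => measurable_pi_apply (xs j c l)).aestronglyMeasurable)
    (fun j c => (Finset.measurable_prod (Jm j c) fun l _ => measurable_pi_apply (xs j c l)).aestronglyMeasurable)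
    (fun j c p _ => integrable_abs_monomial_pow_shift hK₁ u₁ hdiag₁ (Jm j c) (xs j c) p)
    (fun j c p _ => integrable_abs_monomial_pow_kernel hK₀ hdiag₀ (Jm j c) (xs j c) p)
    (fun _ => (2 : ℝ) ^ N * 2 ^ 2 ^ N * ((N : ℝ) * R ^ N * ε))
    fun f => (abs_ursellOf_monomials_shift_sub_kernel_le hK₁ hK₀ u₁ (fun j => Jm j (f j)) (fun j => xs j (f j)) hR hε
      (fun j l hl => hu₁R j (f j) l hl)
      (fun j j' l hl l' hl' => hK₁R j (f j) j' (f j') l hl l' hl') (fun j j' l hl l' hl' => hK₀R j (f j) j' (f j') l hl l' hl')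
      (fun j l hl => huε j (f j) l hl) (fun j j' l hl l' hl' => hKε j (f j) j' (f j') l hl l' hl')).trans
      (condFreeConst_mono hR hε (hNf f))).trans (le_of_eq ?_)
  rw [← Finset.sum_mul, Literature.MathematicalPhysics.QuantumFieldTheory.Balaban1983to89.B1Eq324BenfattoSect5PolyClusters.sum_prod_abs_eq_prod_sum]

end ShiftVsKernel

end Literature.MathematicalPhysics.QuantumFieldTheory.Balaban1983to89.B1Eq324BenfattoKernelSect5PolyClusters
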